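import Summits.QuantumFields.BalabanUV.Beta.EriceRemainderEnclosureHistoryAutonomyComparisonAgeCompositionNextRowAges
import Summits.QuantumFields.BalabanUV.Beta.EriceRemainderEnclosureHistoryAutonomyComparisonAgeCompositionInteriorPins
import Summits.QuantumFields.BalabanUV.Beta.EriceRemainderEnclosureHistoryAutonomyComparisonAgeCompositionGeometricCover

/-!
# EriceRemainderEnclosureHistoryAutonomyComparisonAgeCompositionGeometricCoverFlow — (E114d) route (N), first order: THE GEOMETRIC COVER ALONG THE FLOW —
# THE FIRST END CRITERION BEYOND MASS ONE FOR OLD-DOMINATED PROFILES (undamped first-order model).  Along every box solution of an isotone memory with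
# floor the levels are concave, so a deeper row reads every common column at least `2^{−3∕2}` times as strongly as the row above it: for `j < l < k`,
# `a_{m+k+1+j} ≤ 2·a_{m+k}` ((E58b) `mul_invSq_add_le`), i.e. `(√2∕4)·h(m+k)³ ≤ h(m+k+1+j)³` (**`cube_dominated`**), hence for the undamped aggregate kernel
# `(√2∕4)·KA 1 m l ≤ KA 1 (m+1+j) (l−1−j)` (**`aggregate_dominated_undamped`**: the deeper row carries the SAME ages at the common column, one level deeper each,
# plus younger ones).  (E114c) `sol_nonneg_le_of_geometric_cover_exp` with `r = √2∕4` then gives **`flow_nonneg_of_geometric_cover_undamped`**: `L ≥ 0` dominated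
# by the isotone memory `B` (floor `b > 0`), `h` a box solution, `g ≡ 1`, ANY profile, ANY range, ANY horizon; IF at every pin
#     `Σ_{l<K} r·KA 1 m l ∕ (1 − r·KA 1 m l) ≤ −log(1 − r)`,   `r = √2∕4`   (and `r·KA 1 m l < 1`),
# THEN `0 ≤ ε ≤ e` for every admissible excess.  READING (README `HOME/b2b-balaban-beta-d4-p2/g95/README.md` §2 (d), §6): for rows with small entries (old-dominated
# profiles, top entry `F ≈ 0.02` on the old-only frontier) the criterion is `T(m) ≲ (1 − rF)·log(1∕(1−r))∕r = 1.234·(1 − 0.354·F)` — mass up to ≈ 1.22 against the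
# light load's 1 and the next-row certificate's ≈ `1 + F` — i.e. the old-only frontier moves from K ≈ 2^22 (where (YO) dies, T = 1.03) to K ≈ 2^27; the LP-OPTIMAL
# cover there has mass 0.68–0.75 (README §5), so the depth-dependent sharpening of (E114f∕g) (shallow equations dominate old columns almost fully) has room to spare.

Cell `pub-balaban`, β-function sub-cell, BINDER row D4 «RemainderConst leaves for Bałaban's split» (`HOME/BINDER-OWNERS.md`; owner lineage `b2b-balaban-beta-an4`;
this file by co-owner #2 lineage `b2b-balaban-beta-d4-p2`, generation 95), β-FLOW TEAM duty (1), FREEZE (0) honoured (def-free; imports (E113d), (E113e), (E114c);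
uses (E114c) `sol_nonneg_le_of_geometric_cover_exp`, (E113d) `aggregate_one_eq`, (E80a) `weight_nonneg`, (E86a) `sum_range_of_le` ∕ `aggregate_eq_zero_of_horizon`,
(E58b) `mul_invSq_add_le` BY NAME; the display of `KL`, `KA`, `RA` is (E86i)'s VERBATIM; nothing restated).

HONEST FRAMING (page 1, verbatim and binding).  *"Discharging BetaPertH makes Bałaban's UV stability UNCONDITIONAL — a real constructive-QFT result; it is
NOT the continuum limit and NOT the Clay problem."*  THIS FILE DISCHARGES NOTHING OF THE KIND.  Elementary real analysis about ABSTRACT functionals on a box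
]0,γ]^ℕ with displayed floors, profiles and signs, and the FIRST-ORDER renewal objects of route (N) built from them — hypotheses of a census, not facts; the
form, signs, ages and moments of Bałaban's (1.22) limit functional are NOT PRINTED ([I] p. 298; GAPS G-t4-U2-1∕-2) and NOT asserted.  Row D4 class
UNCHANGED (critical-path width 0; instance 0∕1; D4 DISCHARGE NO DATE).  HONEST DEPENDENCY: continuum YM on T⁴ ⇐ BetaPertH ∧ nine spine estimates (0/9
proved); BetaPertH ⇐ (D1) ∧ (D4) ∧ CAP+tail; G-an2-4 gates asym, D1 and NE2/3/4.

NOT CLAIMED: the criterion along every admissible flow for every profile (it is a finite-range criterion: sup T ~ 0.03·log₂K, README §4); the damped system (the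
deeper rows carry `j+1` more damping factors at the common column — a damping floor would enter as `g₀^{j+1}`); anything printed — NOT B12 Thm 2, NOT BetaPertH.

WHAT IS PROVED ([folklore]; 0 `def`, 0 sorry).  §1 `invSq_le_two_mul`, **`cube_dominated`**.  §2 **`aggregate_dominated_undamped`**.  §3
**`flow_nonneg_of_geometric_cover_undamped`**.
-/
noncomputable section
open Finset

namespace Summit.QuantumFields.BalabanUV.Beta.EriceRemainderEnclosureHistoryAutonomyComparisonAgeCompositionGeometricCoverFlow

open Literature.MathematicalPhysics.QuantumFieldTheory.Balaban1983to89
open Literature.MathematicalPhysics.QuantumFieldTheory.Balaban1983to89.T4BetaStationary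
open Literature.MathematicalPhysics.QuantumFieldTheory.Balaban1983to89.T4BetaFlowWellPosed
open Summit.QuantumFields.BalabanUV.Beta.EriceRemainderEnclosureHistoryAutonomyComparisonAffineProfile (mul_invSq_add_le)
open Summit.QuantumFields.BalabanUV.Beta.EriceRemainderEnclosureHistoryAutonomyComparisonAgeCompositionIdentification (weight_nonneg)
open Summit.QuantumFields.BalabanUV.Beta.EriceRemainderEnclosureHistoryAutonomyComparisonAgeCompositionDecayHorizon (sum_range_of_le aggregate_eq_zero_of_horizon)
open Summit.QuantumFields.BalabanUV.Beta.EriceRemainderEnclosureHistoryAutonomyComparisonAgeCompositionNextRowAges (aggregate_one_eq)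
open Summit.QuantumFields.BalabanUV.Beta.EriceRemainderEnclosureHistoryAutonomyComparisonAgeCompositionGeometricCover (sol_nonneg_le_of_geometric_cover_exp)

variable {B : (ℕ → ℝ) → ℝ} {γ b gIR : ℝ} {L : ℕ → ℝ} {K : ℕ} {h g : ℕ → ℝ} {KL : ℕ → ℕ → ℕ → ℝ}

/-! ## §1 Concavity: a deeper level within the window is at most twice the level -/

/-- **`a_{n+1+d} ≤ 2·a_n` for `d + 1 ≤ n`** along every box solution of an isotone memory with floor (concavity (E58b) `mul_invSq_add_le`). [folklore] -/
theorem invSq_le_two_mul (hmono : ∀ u v : ℕ → ℝ, SeqBox γ u → SeqBox γ v → (∀ j, u j ≤ v j) → B u ≤ B v) (hb : 0 < b)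
    (hlo : ∀ u, SeqBox γ u → b ≤ B u) (hh : SeqBox γ h) (hf : MemFlow B gIR h) {n d : ℕ} (hdn : d + 1 ≤ n) :
    1 / h (n + (d + 1)) ^ 2 ≤ 2 * (1 / h n ^ 2) := by
  have hgIR : 0 < gIR := by rw [← hf.1]; exact (hh 0).1
  have hc := mul_invSq_add_le hmono hb hlo hgIR hh hf n (d + 1)
  have hn : (0 : ℝ) < n := by exact_mod_cast (show 0 < n by omega)
  have hdn' : ((d + 1 : ℕ) : ℝ) ≤ n := by exact_mod_cast hdn
  have hpos : 0 ≤ 1 / h n ^ 2 := by have := (hh n).1; positivity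
  -- `n·a_{n+d+1} ≤ (n+d+1)·a_n ≤ 2n·a_n`
  have h2 : (n : ℝ) * (1 / h (n + (d + 1)) ^ 2) ≤ (n : ℝ) * (2 * (1 / h n ^ 2)) := by
    push_cast at hc hdn'
    nlinarith
  exact le_of_mul_le_mul_left h2 hn

/-- **THE CUBE DOMINATION**: `(√2∕4)·h(m+k)³ ≤ h(m+k+1+j)³` for `j + 1 ≤ m + k` (so for all lags `j < l < k`). [folklore] -/
theorem cube_dominated (hmono : ∀ u v : ℕ → ℝ, SeqBox γ u → SeqBox γ v → (∀ j, u j ≤ v j) → B u ≤ B v) (hb : 0 < b)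
    (hlo : ∀ u, SeqBox γ u → b ≤ B u) (hh : SeqBox γ h) (hf : MemFlow B gIR h) {m k j : ℕ} (hj : j + 1 ≤ m + k) :
    Real.sqrt 2 / 4 * h (m + k) ^ 3 ≤ h (m + k + 1 + j) ^ 3 := by
  have hx := (hh (m + k)).1
  have hy := (hh (m + k + 1 + j)).1
  have ha := invSq_le_two_mul hmono hb hlo hh hf (n := m + k) (d := j) hj
  rw [show m + k + (j + 1) = m + k + 1 + j by ring] at ha
  -- `x² ≤ 2y²`
  have hsq : h (m + k) ^ 2 ≤ 2 * h (m + k + 1 + j) ^ 2 := by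
    rw [div_le_iff₀ (by positivity)] at ha
    have e : 2 * (1 / h (m + k) ^ 2) * h (m + k + 1 + j) ^ 2 = 2 * h (m + k + 1 + j) ^ 2 / h (m + k) ^ 2 := by ring
    rw [e, le_div_iff₀ (by positivity), one_mul] at ha
    exact ha
  -- `x ≤ √2·y`
  have hlin : h (m + k) ≤ Real.sqrt 2 * h (m + k + 1 + j) := by
    have e1 : Real.sqrt (h (m + k) ^ 2) = h (m + k) := Real.sqrt_sq hx.le
    have e2 : Real.sqrt (2 * h (m + k + 1 + j) ^ 2) = Real.sqrt 2 * h (m + k + 1 + j) := by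
      rw [Real.sqrt_mul (by norm_num), Real.sqrt_sq hy.le]
    rw [← e1, ← e2]
    exact Real.sqrt_le_sqrt hsq
  have hs2 : Real.sqrt 2 * Real.sqrt 2 = 2 := Real.mul_self_sqrt (by norm_num)
  have hs0 : 0 < Real.sqrt 2 := by positivity
  -- `x³ = x²·x ≤ 2y²·√2 y`
  have h3 : h (m + k) ^ 3 ≤ 2 * Real.sqrt 2 * h (m + k + 1 + j) ^ 3 := by
    calc h (m + k) ^ 3 = h (m + k) ^ 2 * h (m + k) := by ring
      _ ≤ (2 * h (m + k + 1 + j) ^ 2) * (Real.sqrt 2 * h (m + k + 1 + j)) := mul_le_mul hsq hlin hx.le (by positivity)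
      _ = 2 * Real.sqrt 2 * h (m + k + 1 + j) ^ 3 := by ring
  calc Real.sqrt 2 / 4 * h (m + k) ^ 3 ≤ Real.sqrt 2 / 4 * (2 * Real.sqrt 2 * h (m + k + 1 + j) ^ 3) :=
        mul_le_mul_of_nonneg_left h3 (by positivity)
    _ = h (m + k + 1 + j) ^ 3 := by
        have : Real.sqrt 2 / 4 * (2 * Real.sqrt 2) = 1 := by nlinarith [hs2]
        calc Real.sqrt 2 / 4 * (2 * Real.sqrt 2 * h (m + k + 1 + j) ^ 3) = (Real.sqrt 2 / 4 * (2 * Real.sqrt 2)) * h (m + k + 1 + j) ^ 3 := by ring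
          _ = h (m + k + 1 + j) ^ 3 := by rw [this, one_mul]

/-! ## §2 Deeper rows dominate up to `√2∕4` (undamped) -/

/-- **DEEPER-ROW DOMINATION OF THE UNDAMPED AGGREGATE KERNEL**: `g ≡ 1`, `j < l` ⟹ `(√2∕4)·KA 1 m l ≤ KA 1 (m+1+j) (l−1−j)` — the equation `m+1+j` reads the
common column `m+1+l` through the same ages `k > l` (one factor `h(m+1+j+k)³ ≥ (√2∕4)h(m+k)³` each) and through the younger ages `l−j ≤ k ≤ l` besides
(`j < l`; for `l ≥ K` both sides vanish termwise).
[folklore] -/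
theorem aggregate_dominated_undamped (hmono : ∀ u v : ℕ → ℝ, SeqBox γ u → SeqBox γ v → (∀ j, u j ≤ v j) → B u ≤ B v)
    (hL : ∀ k, 0 ≤ L k) (hb : 0 < b) (hlo : ∀ u, SeqBox γ u → b ≤ B u) (hh : SeqBox γ h) (hf : MemFlow B gIR h) (hg1 : ∀ t, g t = 1) (hK : 1 ≤ K)
    (hKL : ∀ k n l, KL k n l = if 0 < k ∧ k < K ∧ l < k then L k * h (n + k) ^ 3 / 2 * ∏ t ∈ Ico (n + 1 + l) (n + k + 1), g t else 0)
    {KA : ℕ → ℕ → ℕ → ℝ} (hKA : ∀ i m l, KA i m l = KL i m l + KA (i + 1) m l) (hKAtop : ∀ m l, KA K m l = 0)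
    {m j l : ℕ} (hjl : j < l) :
    Real.sqrt 2 / 4 * KA 1 m l ≤ KA 1 (m + 1 + j) (l - 1 - j) := by
  have hg : ∀ t, 0 < g t ∧ g t ≤ 1 := fun t => by rw [hg1 t]; norm_num
  have hh0 : ∀ n, 0 < h n := fun n => (hh n).1
  have hKL0 := weight_nonneg hL hh0 hg hKL
  have hprod : ∀ a c : ℕ, ∏ t ∈ Ico a c, g t = 1 := fun a c => prod_eq_one fun t _ => hg1 t
  rw [aggregate_one_eq hK hKA hKAtop m l, aggregate_one_eq hK hKA hKAtop (m + 1 + j) (l - 1 - j), mul_sum]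
  refine sum_le_sum fun k hk => ?_
  have hk := mem_Ico.mp hk
  by_cases hlk : l < k
  · -- the same age, one level deeper
    rw [hKL k m l, if_pos ⟨hk.1, hk.2, hlk⟩, hKL k (m + 1 + j) (l - 1 - j), if_pos ⟨hk.1, hk.2, by omega⟩, hprod, hprod, mul_one, mul_one,
      show m + 1 + j + k = m + k + 1 + j by ring]
    have hc := cube_dominated hmono hb hlo hh hf (m := m) (k := k) (j := j) (by omega)
    have := mul_le_mul_of_nonneg_left hc (show 0 ≤ L k / 2 by have := hL k; positivity)
    calc Real.sqrt 2 / 4 * (L k * h (m + k) ^ 3 / 2) = L k / 2 * (Real.sqrt 2 / 4 * h (m + k) ^ 3) := by ring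
      _ ≤ L k / 2 * h (m + k + 1 + j) ^ 3 := this
      _ = L k * h (m + k + 1 + j) ^ 3 / 2 := by ring
  · rw [hKL k m l, if_neg (by omega), mul_zero]
    exact hKL0 k (m + 1 + j) (l - 1 - j)

/-! ## §3 The END by the geometric cover along the undamped flow -/

/-- **ROUTE (N), FIRST ORDER — THE END BY THE GEOMETRIC COVER (UNDAMPED; ANY PROFILE, ANY RANGE, ANY HORIZON).**  `B` an isotone memory on the box with floor
`b > 0` dominating the profile `L ≥ 0` on the ages `< K` (`K ≥ 1`); `h` a box solution from any pin; `g ≡ 1`; `KL`, `KA`, `RA` as displayed ((E86i) verbatim);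
horizon `N ≥ K`; `r = √2∕4`.  IF at every pin `r·KA 1 m l < 1` and
`Σ_{l<K} r·KA 1 m l∕(1 − r·KA 1 m l) ≤ −log(1 − r)`,
THEN the comparison surplus of every admissible excess satisfies `0 ≤ ε m ≤ e m` at every pin ((E114c) `sol_nonneg_le_of_geometric_cover_exp` with the domination
of §2). [folklore] -/
theorem flow_nonneg_of_geometric_cover_undamped (hmono : ∀ u v : ℕ → ℝ, SeqBox γ u → SeqBox γ v → (∀ j, u j ≤ v j) → B u ≤ B v)
    (hL : ∀ k, 0 ≤ L k) (hb : 0 < b) (hlo : ∀ u, SeqBox γ u → b ≤ B u) (hh : SeqBox γ h) (hf : MemFlow B gIR h) (hg1 : ∀ t, g t = 1)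
    (hK : 1 ≤ K) {N : ℕ} (hKN : K ≤ N)
    (hKL : ∀ k n l, KL k n l = if 0 < k ∧ k < K ∧ l < k then L k * h (n + k) ^ 3 / 2 * ∏ t ∈ Ico (n + 1 + l) (n + k + 1), g t else 0)
    {KA : ℕ → ℕ → ℕ → ℝ} {RA : ℕ → (ℕ → ℝ) → ℕ → ℝ}
    (hRA : ∀ i v m, RA i v m = ∑ l ∈ range K, KA i m l * v (m + 1 + l))
    (hKA : ∀ i m l, KA i m l = KL i m l + KA (i + 1) m l) (hKAtop : ∀ m l, KA K m l = 0)
    (hrt : ∀ m l, Real.sqrt 2 / 4 * KA 1 m l < 1)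
    (hcrit : ∀ m, ∑ l ∈ range K, Real.sqrt 2 / 4 * KA 1 m l / (1 - Real.sqrt 2 / 4 * KA 1 m l) ≤ -Real.log (1 - Real.sqrt 2 / 4))
    {e ε : ℕ → ℝ} (he0 : ∀ m, 0 ≤ e m) (hea : ∀ m, e (m + 1) ≤ e m)
    (hεt : ∀ m, N < m → ε m = 0) (hεrec : ∀ m, ε m = e m - RA 1 ε m) : ∀ m, 0 ≤ ε m ∧ ε m ≤ e m := by
  have hg : ∀ t, 0 < g t ∧ g t ≤ 1 := fun t => by rw [hg1 t]; norm_num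
  have hh0 : ∀ n, 0 < h n := fun n => (hh n).1
  have hKL0 := weight_nonneg hL hh0 hg hKL
  have hKLK : ∀ i m l, K ≤ l + 1 → KL i m l = 0 := fun i m l hl => by rw [hKL, if_neg (by omega)]
  have hKLtop : ∀ i m l, K ≤ i → KL i m l = 0 := fun i m l hi => by rw [hKL, if_neg (by omega)]
  have hKA0 : ∀ i m l, K ≤ l → KA i m l = 0 :=
    aggregate_eq_zero_of_horizon hKA hKAtop (fun i m l hl => hKLK i m l (by omega)) hKLtop
  have hKA10 : ∀ m l, 0 ≤ KA 1 m l := fun m l => by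
    rw [aggregate_one_eq hK hKA hKAtop]; exact sum_nonneg fun k _ => hKL0 k m l
  have hRA' : ∀ v m, RA 1 v m = ∑ l ∈ range N, KA 1 m l * v (m + 1 + l) := fun v m => by
    rw [hRA]; exact sum_range_of_le hKN fun l hl => by rw [hKA0 1 m l hl, zero_mul]
  have hr0 : 0 < Real.sqrt 2 / 4 := by positivity
  have hr1 : Real.sqrt 2 / 4 < 1 := by
    have : Real.sqrt 2 < 2 := by
      rw [show (2 : ℝ) = Real.sqrt (2 ^ 2) by rw [Real.sqrt_sq (by norm_num)]]
      exact Real.sqrt_lt_sqrt (by norm_num) (by norm_num)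
    linarith
  refine sol_nonneg_le_of_geometric_cover_exp (K := KA 1) (R := RA 1) hRA' hKA10 hr0 hr1 hrt (fun n j l hjl hlN => ?_) (fun n => ?_)
    he0 hea hεt hεrec
  · exact aggregate_dominated_undamped hmono hL hb hlo hh hf hg1 hK hKL hKA hKAtop hjl
  · rw [← sum_range_of_le hKN fun l hl => by rw [hKA0 1 n l hl]; simp]
    exact hcrit n

end Summit.QuantumFields.BalabanUV.Beta.EriceRemainderEnclosureHistoryAutonomyComparisonAgeCompositionGeometricCoverFlow

end
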